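import Summits.CriticalPhenomena.PercolationContinuityZ3.Theorems.PercNearOneGluingNoHeavyQuantClosingPivotalSteepness
import Literature.Probability.Percolation.ChemicalDistance
import Literature.Probability.Percolation.UniquenessInfiniteCluster
import Mathlib.MeasureTheory.Integral.Indicator
import HarnessLib

/-!
# THE INTRINSIC (CHEMICAL) RADIUS HAS AT MOST `r` CLOSING-PIVOTAL EDGES, hence
# `q^{-r} P_q(Rad_int(C) ≥ r)` is non-increasing in `q`: `P_q(Rad_int ≥ r) ≤ (q/p)^r P_p(Rad_int ≥ r)` (`0 < p ≤ q < 1`),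
# on every finite step graph and, by box exhaustion, on `ℤ^d` — quant lane, seat p4 gen 38, file 2

builds on p205010 (kernel theorem, internal audit signed; external expert review pending) — NOT used in this file.
Seat `prim-quant-p4`, `--supports stmt-CriticalPhenomena-4575`; pure proofs, no definitions (`local notation3` only).

The event is the tree's `Chemical.far K v r = {∂B(v, r; K) ≠ ∅}` (Kozma–Nachmias' `H(r; K)`: some site of the open
`K`-cluster of `v` lies at chemical distance `≥ r`; `ChemicalDistance.lean`).  It is NOT monotone (opening an edge can create a
shortcut), so neither Russo's formula for increasing events nor the absolute-value Russo inequality is of use; but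
(Hutchcroft 2022, proof of Lemma 2.1) an OPEN edge whose closing destroys the event lies on every geodesic of length `r`, so the
open closing-pivotal edges lie in a set of `≤ r` edges — exactly the hypothesis of file 1 (`…QuantClosingPivotalSteepness`).

* §1 `ChemRad.exists_geodesic_closePivotal` — the combinatorial fact, for every step graph `K` on any vertex type.
* §2 `ChemRad.far_real_le_pow_mul_real`, `ChemRad.far_pow_mul_real_le_real` — for a step graph `K ≤ G` with finitely many
  edges: `P_q(far K v r) ≤ (q/p)^r P_p(far K v r)` and `(p/q)^r P_q(far K v r) ≤ P_p(far K v r)`, `0 < p ≤ q < 1`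
  (`P = bondPercolation G`).
* §3 `ℤ^d`, `d` arbitrary: the box step graphs `K_N = (edges of ℤ^d inside Λ_N)` exhaust the lattice event —
  `ChemRad.far_box_subset_far` (`N ≥ r`), `ChemRad.exists_forall_mem_far_box`, `ChemRad.tendsto_real_far_box`
  (`P_p(far K_N 0 r) → P_p(far ℤ^d 0 r)`) — hence **`ChemRad.real_far_le_pow_mul_real_far`** and
  **`ChemRad.pow_mul_real_far_le_real_far`**: for `0 < p ≤ q < 1` and every `r`,
  `P_q(Rad_int(C(0)) ≥ r) ≤ (q/p)^r · P_p(Rad_int(C(0)) ≥ r)` on `ℤ^d` (Hutchcroft's Lemma 2.1 / Prop. 4.2 mechanism, with the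
  sharper factor `(q/p)^r ≤ e^{r(q−p)/p}`).

The consequences at `p_c` (every `d ≥ 2`: `P_{p_c}(Rad_int ≥ r) ≥ 1/(e(1−p_c)(r+1))`; the lossless chemical (T2)-dictionary;
high dimensions) are in the sequel `…QuantChemicalRadiusCritical`.

HONEST STATUS.  REPRODUCTION (first formalisation) of the mechanism of Hutchcroft 2022 Lemma 2.1 / Prop. 4.2 for `ℤ^d`
(there: quasi-transitive graphs, finite subgraphs `H`; the passage to the infinite lattice event is routine and done here by box
exhaustion).  NO rate, NO exponent for `d = 3`; (T1)/(T2) and the lane's honest sentence UNCHANGED.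

References: T. Hutchcroft, Proc. Lond. Math. Soc. 125 (2022) 968–1013, arXiv:2002.02916, Lemma 2.1, Prop. 4.2
[Hutchcroft2022SlightlySupercritical]; G. Kozma, A. Nachmias, Invent. Math. 178 (2009) §1.3 [KozmaNachmias2009].
-/

noncomputable section

namespace Summit.CriticalPhenomena.PercolationContinuityZ3.Theorems

open MeasureTheory Set Filter Topology Literature.Probability.Percolation Literature.Probability.LatticeModels
open Literature.Probability.Percolation.Chemical
open scoped Classical

namespace ChemRad

variable {V : Type*}

/-! ### §1. Closing an edge off a geodesic does not destroy `{∂B(v, r; K) ≠ ∅}` -/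

/-- Shrinking the configuration shrinks the open `K`-graph. [folklore] -/
theorem openGraph_inf_mono {ω ω' : BondConfig V} (h : ω' ⊆ ω) (K : SimpleGraph V) :
    openGraph ω' ⊓ K ≤ openGraph ω ⊓ K := by
  intro a b hab
  rw [SimpleGraph.inf_adj, openGraph_adj] at hab ⊢
  exact ⟨⟨h hab.1.1, hab.1.2⟩, hab.2⟩

/-- The graph distance is antitone in the graph (between points joined in the smaller graph). [folklore] -/
theorem dist_anti {H H' : SimpleGraph V} (hle : H' ≤ H) {u z : V} (hr : H'.Reachable u z) :
    H.dist u z ≤ H'.dist u z := by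
  obtain ⟨w, hw⟩ := hr.exists_walk_length_eq_dist
  have h := SimpleGraph.dist_le (w.map (SimpleGraph.Hom.ofLE hle))
  rwa [SimpleGraph.Walk.length_map, hw] at h

/-- **The closing-pivotal edges of `{∂B(v, r; K) ≠ ∅}` lie on one geodesic of length `r`.**  If `ω ∈ far K v r`, there is a
set `T` of at most `r` edges (the edges of an open `K`-geodesic from `v` to a site at chemical distance exactly `r`) such that
every open edge `e` with `ω ∖ {e} ∉ far K v r` belongs to `T` (closing an edge off the geodesic keeps the geodesic open and
cannot decrease any distance).  [cite: Hutchcroft2022SlightlySupercritical, Lemma 2.1 (proof)] -/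
theorem exists_geodesic_closePivotal (K : SimpleGraph V) (v : V) (r : ℕ) {ω : BondConfig V} (hω : ω ∈ far K v r) :
    ∃ T : Finset (Sym2 V), T.card ≤ r ∧ ∀ e : Sym2 V, e ∈ ω → ω \ {e} ∉ far K v r → e ∈ T := by
  obtain ⟨z, hz⟩ := level_nonempty_of_far hω le_rfl
  obtain ⟨w, hw⟩ := hz.1.exists_walk_length_eq_dist
  refine ⟨w.edges.toFinset, ?_, fun e _ hnot => ?_⟩
  · refine le_trans (List.toFinset_card_le w.edges) ?_
    rw [SimpleGraph.Walk.length_edges, hw, hz.2]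
  · by_contra heT
    rw [List.mem_toFinset] at heT
    -- the geodesic `w` avoids `e`, so it survives the closing of `e`
    have hedges : ∀ e' ∈ w.edges, e' ∈ (openGraph (ω \ {e}) ⊓ K).edgeSet := by
      intro e' he'
      have hne : e' ≠ e := fun h => heT (h ▸ he')
      induction e' using Sym2.ind with
      | h a b =>
        have hab := w.adj_of_mem_edges he'
        rw [SimpleGraph.inf_adj, openGraph_adj] at hab
        rw [SimpleGraph.mem_edgeSet, SimpleGraph.inf_adj, openGraph_adj]
        exact ⟨⟨⟨hab.1.1, hne⟩, hab.1.2⟩, hab.2⟩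
    have hreach : (openGraph (ω \ {e}) ⊓ K).Reachable v z := ⟨w.transfer _ hedges⟩
    refine hnot ⟨z, hreach, ?_⟩
    have hle : openGraph (ω \ {e}) ⊓ K ≤ openGraph ω ⊓ K := openGraph_inf_mono Set.sdiff_subset K
    have := dist_anti hle hreach
    rw [hz.2] at this
    exact this

/-! ### §2. Finite step graphs: `P_q(far K v r) ≤ (q/p)^r P_p(far K v r)` -/

/-- **`P_q(∂B(v,r;K) ≠ ∅) ≤ (q/p)^r · P_p(∂B(v,r;K) ≠ ∅)`** for `0 < p ≤ q < 1`, for every step graph `K ≤ G` with finitely many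
edges (`P = bondPercolation G`; file 1's closing-pivotal steepness with §1).
[cite: Hutchcroft2022SlightlySupercritical, Lemma 2.1 (proof, integrated)] -/
theorem far_real_le_pow_mul_real (G K : SimpleGraph V) (hKG : K ≤ G) (hfin : K.edgeSet.Finite) (v : V) (r : ℕ)
    (p q : unitInterval) (hp0 : 0 < (p : ℝ)) (hpq : (p : ℝ) ≤ q) (hq1 : (q : ℝ) < 1) :
    (bondPercolation G q).real (far K v r) ≤ ((q : ℝ) / p) ^ r * (bondPercolation G p).real (far K v r) := by
  have hF : (↑hfin.toFinset : Set (Sym2 V)) ⊆ G.edgeSet := by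
    rw [Set.Finite.coe_toFinset]; exact SimpleGraph.edgeSet_subset_edgeSet.2 hKG
  have hB : DeterminedBy (far K v r) (↑hfin.toFinset : Set (Sym2 V)) := by
    rw [Set.Finite.coe_toFinset]; exact determinedBy_far K v r
  exact real_le_pow_mul_real G hF hB (fun ω hω => by
    obtain ⟨T, hT, h⟩ := exists_geodesic_closePivotal K v r hω
    exact ⟨T, hT, fun e _ he hne => h e he hne⟩) p q hp0 hpq hq1

/-- **`(p/q)^r · P_q(∂B(v,r;K) ≠ ∅) ≤ P_p(∂B(v,r;K) ≠ ∅)`** for `0 < p ≤ q < 1` (the same, read downwards), every step graph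
`K ≤ G` with finitely many edges. [cite: Hutchcroft2022SlightlySupercritical, Prop. 4.2 (proof)] -/
theorem far_pow_mul_real_le_real (G K : SimpleGraph V) (hKG : K ≤ G) (hfin : K.edgeSet.Finite) (v : V) (r : ℕ)
    (p q : unitInterval) (hp0 : 0 < (p : ℝ)) (hpq : (p : ℝ) ≤ q) (hq1 : (q : ℝ) < 1) :
    ((p : ℝ) / q) ^ r * (bondPercolation G q).real (far K v r) ≤ (bondPercolation G p).real (far K v r) := by
  have hF : (↑hfin.toFinset : Set (Sym2 V)) ⊆ G.edgeSet := by
    rw [Set.Finite.coe_toFinset]; exact SimpleGraph.edgeSet_subset_edgeSet.2 hKG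
  have hB : DeterminedBy (far K v r) (↑hfin.toFinset : Set (Sym2 V)) := by
    rw [Set.Finite.coe_toFinset]; exact determinedBy_far K v r
  exact pow_mul_real_le_real G hF hB (fun ω hω => by
    obtain ⟨T, hT, h⟩ := exists_geodesic_closePivotal K v r hω
    exact ⟨T, hT, fun e _ he hne => h e he hne⟩) p q hp0 hpq hq1

/-! ### §3. `ℤ^d`: exhaustion of the lattice event by the box step graphs -/

variable {d : ℕ}

/-- `K_N`: the step graph of `ℤ^d` whose edges are the lattice edges with both endpoints in the box `Λ_N`. -/
local notation3 "KB[" N "]" =>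
  SimpleGraph.fromEdgeSet (↑(edgesIn (zdGraph d) (box d N)) : Set (Sym2 (Site d)))

/-- `K_N ≤ ℤ^d`. [folklore] -/
theorem boxGraph_le (N : ℕ) : KB[N] ≤ zdGraph d := by
  intro x y hxy
  rw [SimpleGraph.fromEdgeSet_adj, Finset.mem_coe, mem_edgesIn_iff] at hxy
  exact hxy.1.1

/-- `K_N` has finitely many edges. [folklore] -/
theorem boxGraph_edgeSet_finite (N : ℕ) : (KB[N] : SimpleGraph (Site d)).edgeSet.Finite := by
  rw [SimpleGraph.edgeSet_fromEdgeSet]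
  exact (Finset.finite_toSet _).subset Set.sdiff_subset

/-- The vertices of a lattice walk of length `ℓ` started in `Λ_n` lie in `Λ_{n+ℓ}`. [folklore] -/
theorem mem_box_of_mem_support {n : ℕ} {x y : Site d} (w : (zdGraph d).Walk x y) (hx : x ∈ box d n) :
    ∀ u ∈ w.support, u ∈ box d (n + w.length) := by
  induction w generalizing n with
  | nil => intro u hu; rw [SimpleGraph.Walk.support_nil, List.mem_singleton] at hu; subst hu; simpa using hx
  | @cons a b c hab p ih =>
    intro u hu
    rw [SimpleGraph.Walk.support_cons, List.mem_cons] at hu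
    rw [SimpleGraph.Walk.length_cons]
    rcases hu with rfl | hu
    · exact box_mono d (by omega) hx
    · have := ih (mem_box_succ_of_adj hx hab) u hu
      exact box_mono d (by omega) this

/-- An open lattice walk from the origin of length `≤ N` is an open `K_N`-walk: all its edges are edges of
`openGraph ω ⊓ K_N`. [folklore] -/
theorem edges_mem_boxGraph {ω : BondConfig (Site d)} {z : Site d} (w : (openGraph ω ⊓ zdGraph d).Walk 0 z) {N : ℕ}
    (hN : w.length ≤ N) : ∀ e ∈ w.edges, e ∈ (openGraph ω ⊓ KB[N]).edgeSet := by
  have hsupp : ∀ u ∈ w.support, u ∈ box d N := by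
    intro u hu
    have h := mem_box_of_mem_support (w.map (SimpleGraph.Hom.ofLE inf_le_right)) (zero_mem_box d 0) u
      (by rw [SimpleGraph.Walk.support_map]; exact List.mem_map.2 ⟨u, hu, rfl⟩)
    rw [SimpleGraph.Walk.length_map, zero_add] at h
    exact box_mono d hN h
  intro e he
  induction e using Sym2.ind with
  | h a b =>
    have hab := w.adj_of_mem_edges he
    rw [SimpleGraph.inf_adj, openGraph_adj] at hab
    have ha := hsupp a (w.fst_mem_support_of_mem_edges he)
    have hb := hsupp b (w.snd_mem_support_of_mem_edges he)
    rw [SimpleGraph.mem_edgeSet, SimpleGraph.inf_adj, openGraph_adj, SimpleGraph.fromEdgeSet_adj, Finset.mem_coe,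
      mem_edgesIn_iff]
    refine ⟨hab.1, ⟨(SimpleGraph.mem_edgeSet _).2 hab.2, fun x hx => ?_⟩, hab.1.2⟩
    rcases Sym2.mem_iff.1 hx with rfl | rfl
    exacts [ha, hb]

/-- **`far K_N 0 r ⊆ far ℤ^d 0 r` for `N ≥ r`**: if the box cluster reaches chemical distance `r` but the lattice cluster does
not, a lattice geodesic of length `< r ≤ N` to the far site stays inside `Λ_N`, contradiction. [folklore] -/
theorem far_box_subset_far {r N : ℕ} (hN : r ≤ N) :
    far (KB[N] : SimpleGraph (Site d)) 0 r ⊆ far (zdGraph d) 0 r := by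
  rintro ω ⟨z, hz, hrz⟩
  by_contra hfar
  have hlt : ∀ z', (openGraph ω ⊓ zdGraph d).Reachable 0 z' → (openGraph ω ⊓ zdGraph d).dist 0 z' < r := by
    intro z' hz'
    by_contra h
    exact hfar ⟨z', hz', not_lt.1 h⟩
  have hle : openGraph ω ⊓ KB[N] ≤ openGraph ω ⊓ zdGraph d := inf_le_inf_left _ (boxGraph_le N)
  have hz' : (openGraph ω ⊓ zdGraph d).Reachable 0 z := hz.mono hle
  obtain ⟨w, hw⟩ := hz'.exists_walk_length_eq_dist
  have hwN : w.length ≤ N := by have := hlt z hz'; omega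
  have hdist : (openGraph ω ⊓ KB[N]).dist 0 z ≤ w.length := by
    have := SimpleGraph.dist_le (w.transfer _ (edges_mem_boxGraph w hwN))
    rwa [SimpleGraph.Walk.length_transfer] at this
  have := hlt z hz'
  omega

/-- **Every configuration of the lattice event is eventually in the box events**: if `ω ∈ far ℤ^d 0 r` then
`ω ∈ far K_N 0 r` for all large `N` (any open path to a far site lies in some box; box distances are at least lattice
distances). [folklore] -/
theorem exists_forall_mem_far_box {r : ℕ} {ω : BondConfig (Site d)} (hω : ω ∈ far (zdGraph d) 0 r) :
    ∃ N₀ : ℕ, ∀ N, N₀ ≤ N → ω ∈ far (KB[N] : SimpleGraph (Site d)) 0 r := by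
  obtain ⟨z, hz, hrz⟩ := hω
  obtain ⟨w, -⟩ := hz.exists_walk_length_eq_dist
  refine ⟨w.length, fun N hN => ?_⟩
  have hreach : (openGraph ω ⊓ KB[N]).Reachable 0 z := ⟨w.transfer _ (edges_mem_boxGraph w hN)⟩
  exact ⟨z, hreach, hrz.trans (dist_anti (inf_le_inf_left _ (boxGraph_le N)) hreach)⟩

/-- **`P_p(far K_N 0 r) → P_p(far ℤ^d 0 r)` as `N → ∞`** (the indicators agree eventually, configuration by configuration).
[folklore] -/
theorem tendsto_real_far_box (p : unitInterval) (r : ℕ) :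
    Tendsto (fun N : ℕ => (bondPercolation (zdGraph d) p).real (far (KB[N] : SimpleGraph (Site d)) 0 r)) atTop
      (𝓝 ((bondPercolation (zdGraph d) p).real (far (zdGraph d) 0 r))) := by
  have hmeas : ∀ N : ℕ, MeasurableSet (far (KB[N] : SimpleGraph (Site d)) 0 r) := by
    intro N
    haveI : (KB[N] : SimpleGraph (Site d)).LocallyFinite := fun v =>
      (((zdGraph d).neighborSet v).toFinite.subset fun w (hw : (KB[N]).Adj v w) => boxGraph_le N hw).fintype
    exact measurableSet_far _ 0 r
  have hlim : ∀ ω : BondConfig (Site d), ∀ᶠ N in atTop,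
      ω ∈ far (KB[N] : SimpleGraph (Site d)) 0 r ↔ ω ∈ far (zdGraph d) 0 r := by
    intro ω
    by_cases hω : ω ∈ far (zdGraph d) 0 r
    · obtain ⟨N₀, hN₀⟩ := exists_forall_mem_far_box hω
      filter_upwards [eventually_ge_atTop N₀] with N hN
      exact ⟨fun _ => hω, fun _ => hN₀ N hN⟩
    · filter_upwards [eventually_ge_atTop r] with N hN
      exact ⟨fun h => (hω (far_box_subset_far hN h)).elim, fun h => (hω h).elim⟩
  have h := tendsto_measure_of_tendsto_indicator_of_isFiniteMeasure atTop (bondPercolation (zdGraph d) p) hmeas hlim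
  simp only [measureReal_def]
  exact (ENNReal.tendsto_toReal (measure_ne_top _ _)).comp h

/-- **`P_q(Rad_int(C(0)) ≥ r) ≤ (q/p)^r · P_p(Rad_int(C(0)) ≥ r)` on `ℤ^d`** for `0 < p ≤ q < 1`, every `r` and every `d`:
the closing-pivotal steepness of the intrinsic radius of the cluster of the origin, in infinite volume (§2 on the boxes, then
`N → ∞`).  Equivalently `q ↦ q^{-r} P_q(Rad_int ≥ r)` is non-increasing.
[cite: Hutchcroft2022SlightlySupercritical, Lemma 2.1 (proof, integrated)] -/
theorem real_far_le_pow_mul_real_far (r : ℕ) (p q : unitInterval) (hp0 : 0 < (p : ℝ)) (hpq : (p : ℝ) ≤ q)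
    (hq1 : (q : ℝ) < 1) :
    (bondPercolation (zdGraph d) q).real (far (zdGraph d) 0 r) ≤
      ((q : ℝ) / p) ^ r * (bondPercolation (zdGraph d) p).real (far (zdGraph d) 0 r) :=
  le_of_tendsto_of_tendsto' (tendsto_real_far_box q r) ((tendsto_real_far_box p r).const_mul _) fun N =>
    far_real_le_pow_mul_real (zdGraph d) _ (boxGraph_le N) (boxGraph_edgeSet_finite N) 0 r p q hp0 hpq hq1

/-- **`(p/q)^r · P_q(Rad_int(C(0)) ≥ r) ≤ P_p(Rad_int(C(0)) ≥ r)` on `ℤ^d`** for `0 < p ≤ q < 1`, every `r`, every `d`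
(the downward reading: lowering the density costs at most `(p/q)^r`). [cite: Hutchcroft2022SlightlySupercritical, Prop. 4.2 (proof)] -/
theorem pow_mul_real_far_le_real_far (r : ℕ) (p q : unitInterval) (hp0 : 0 < (p : ℝ)) (hpq : (p : ℝ) ≤ q)
    (hq1 : (q : ℝ) < 1) :
    ((p : ℝ) / q) ^ r * (bondPercolation (zdGraph d) q).real (far (zdGraph d) 0 r) ≤
      (bondPercolation (zdGraph d) p).real (far (zdGraph d) 0 r) :=
  le_of_tendsto_of_tendsto' ((tendsto_real_far_box q r).const_mul _) (tendsto_real_far_box p r) fun N =>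
    far_pow_mul_real_le_real (zdGraph d) _ (boxGraph_le N) (boxGraph_edgeSet_finite N) 0 r p q hp0 hpq hq1

end ChemRad

end Summit.CriticalPhenomena.PercolationContinuityZ3.Theorems

end
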